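import Summits.QuantumFields.YangMills.Theorems.UnitScaleTiltProp7Lane2CutoffCommutators
import Summits.QuantumFields.YangMills.Theorems.UnitScaleTiltProp7SliceBoundBookkeeping
import HarnessLib

/-!
# Route `UnitScaleTilt`, crux «MinimiserStabilityRegPr» (stmt-QuantumFields-19200), E′ ∕ (N06) LANE II «DIVERGENCE RECOVERY AT CURVED `W`» — brick (B6), the SUMMED commutator rows:
# FOR A FAMILY OF CUTOFFS `ζ_c` WITH BOUNDED ALIVE-COUNT, `‖Σ_c (D_W(ζ_cφ_c) − ζ_c D_Wφ_c)‖²` AND `‖Σ_c [Δ_W, ζ_c]φ_c‖²` ARE BOUNDED BY FAMILY SUMS — no overlap geometry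

Cell `ym3-torus`, width seat `ym3-torus-px11` (gen 6); ★p1 g19 (B7-CORE) SIGNATURE 80078390 `norm_sq_le_rows` (its two `‖Σ_i …‖²` slots :223∕:225), PLAN-B7 59f10769, «px11 g6: `Z i`∕`ZE i` = your
ζ-multiplications, rows 1–2 = the two commutator norms».  THEOREMS ONLY (0 `def`, 0 `sorry`); `--supports stmt-QuantumFields-19200`, count-neutral.  YM₃ on T³ is a ladder rung (R3), not the
Clay problem; nothing here claims (B7), (REC), `hN06`, a stub, the crux, d = 4 or the mass gap.

THE MECHANISM.  For a finite family of real cutoffs `ζ_c` (indexed by any finite type, e.g. the sites, vanishing off a centre set `Z`) with (i) at most `k` members alive at any site and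
(ii) per-member steps `≤ a` and second differences `≤ a₂`, the POINTWISE sums `Σ_c |ζ_c(x′) − ζ_c(x)| ≤ 2k·a`, `Σ_c |∂²ζ_c(x)| ≤ 3k·a₂` follow by counting alive members only; then the
weighted Cauchy–Schwarz of ✓ `Prop7SliceBoundBookkeeping.norm_sq_sum_smul_le` (px6), applied ENTRYWISE to the pointwise Leibniz identities of ✓ `…Lane2CutoffCommutators`, bounds the
summed commutators by FAMILY SUMS of global norms — no support bookkeeping of the commutator vectors, no overlap count of patches.
* §1 counting: `sum_abs_sub_le_of_alive`, `sum_abs_second_le_of_alive`.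
* §2 `hs_sum_smul_le` (entrywise weighted Cauchy–Schwarz for matrices), `sum_weight_mul_le` (a weighted family sum is `≤ a·`(unweighted)).
* §3 ★★ `hs_sum_grad_comm_le` — ROW 1 summed, function side: `c₀·Σ_b hs(Σ_c η⁻¹(ζ_c(b₊) − ζ_c(b₋))•Ad(W_b)λ_c(b₊)) ≤ 6k·a²·η⁻²·Σ_c (c₀Σ_x hs(λ_c x))`.
* §4 ★★ `hs_sum_lap_comm_le` — ROW 2 summed, function side: `c₀·Σ_x hs(Σ_c η⁻²[divB D(ζ_cλ_c) − ζ_c divB Dλ_c](x)) ≤ 36k·a²·η⁻²·Σ_c(c₀η⁻²Σ_xΣ_μ hs(D_μλ_c x)) + 81k·a₂²·η⁻⁴·Σ_c(c₀Σ_x hs(λ_c x))`.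
The member-level package (the linear maps `Z i`, `ZE i` on `SiteL2K`∕`BondL2K` with `Σ_i Z i = 1` and these rows in (B7-CORE)'s currency) is the sibling file `…Lane2CutoffPackage`.

References: T. Bałaban, CMP 99 (1985) 389–434 [Balaban1985BackgroundPropagators] ((3.100) pp.413–414; (3.3) p.391, (3.8) p.392, (3.23) p.394); CMP 96 (1984) 223–250
[Balaban1984PropagatorsII] (p.238).
-/

set_option autoImplicit false

noncomputable section

open scoped BigOperators Matrix.Norms.L2Operator Matrix

namespace Summit.QuantumFields.YangMills.Theorems.Prop7Lane2CutoffFamilyRows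

open Literature.MathematicalPhysics.QuantumFieldTheory.Balaban1983to89
open Literature.MathematicalPhysics.QuantumFieldTheory.Balaban1983to89.T3ContinuumYM3Torus
open T3SectALandauChart (bgUnits eta eta_pos)
open B9Eq39Adjoint (R covD covDstar divB)
open B9TorusCalculus (torusT torusT_apply torusT_symm_apply)
open Summit.QuantumFields.YangMills.Theorems.Prop7CovariantCoercivity (sum_norm_sq_R)
open Summit.QuantumFields.YangMills.Theorems.Prop7CovAgmonLetters (hs_smul hs_sum_le hs_covDstar_eq)
open Summit.QuantumFields.YangMills.Theorems.Prop7ConjFrameTransport (divB_covD_smul_fun)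
open Summit.QuantumFields.YangMills.Theorems.Prop7FlatCoercivity (sum_shift)
open Summit.QuantumFields.YangMills.Theorems.Prop7Lane2CutoffCommutators (coe_bgUnits_mem_unitary coe_bgUnits_mem_unitary' sum_pbond_tgt)
open Summit.QuantumFields.YangMills.Theorems.Prop7SliceBoundBookkeeping (norm_sq_sum_smul_le)
open Finset

/-! ## §1 Counting alive members -/

section Count

variable {ι X : Type*} [Fintype ι] [DecidableEq ι]

/-- If at most `k` members are non-zero at `x` and at `x′`, and each member moves by `≤ a`, then `Σ_c |ζ_c(x′) − ζ_c(x)| ≤ 2k·a`. [folklore] -/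
theorem sum_abs_sub_le_of_alive (ζ : ι → X → ℝ) (x x' : X) {k : ℕ} {a : ℝ} (ha : 0 ≤ a)
    (hk : ∀ y : X, (Finset.univ.filter fun c : ι => ζ c y ≠ 0).card ≤ k) (hstep : ∀ c, |ζ c x' - ζ c x| ≤ a) :
    ∑ c : ι, |ζ c x' - ζ c x| ≤ 2 * k * a := by
  classical
  set T := Finset.univ.filter fun c : ι => ζ c x ≠ 0 ∨ ζ c x' ≠ 0 with hT
  have hTcard : (T.card : ℝ) ≤ 2 * k := by
    have h1 : T ⊆ (Finset.univ.filter fun c : ι => ζ c x ≠ 0) ∪ (Finset.univ.filter fun c : ι => ζ c x' ≠ 0) := by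
      intro c hc
      rw [hT, Finset.mem_filter] at hc
      rw [Finset.mem_union, Finset.mem_filter, Finset.mem_filter]
      rcases hc.2 with h | h
      · exact Or.inl ⟨Finset.mem_univ _, h⟩
      · exact Or.inr ⟨Finset.mem_univ _, h⟩
    have h2 := (Finset.card_le_card h1).trans (Finset.card_union_le _ _)
    have h3 := hk x
    have h4 := hk x'
    have : (T.card : ℝ) ≤ ((Finset.univ.filter fun c : ι => ζ c x ≠ 0).card : ℝ) + ((Finset.univ.filter fun c : ι => ζ c x' ≠ 0).card : ℝ) := by
      exact_mod_cast h2
    have h3' : (((Finset.univ.filter fun c : ι => ζ c x ≠ 0).card : ℕ) : ℝ) ≤ k := by exact_mod_cast h3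
    have h4' : (((Finset.univ.filter fun c : ι => ζ c x' ≠ 0).card : ℕ) : ℝ) ≤ k := by exact_mod_cast h4
    linarith
  have hzero : ∀ c ∉ T, |ζ c x' - ζ c x| = 0 := by
    intro c hc
    rw [hT, Finset.mem_filter, not_and] at hc
    have h := hc (Finset.mem_univ c)
    push Not at h
    rw [h.1, h.2, sub_zero, abs_zero]
  rw [← Finset.sum_subset (Finset.subset_univ T) fun c _ hc => hzero c hc]
  calc ∑ c ∈ T, |ζ c x' - ζ c x| ≤ ∑ _c ∈ T, a := Finset.sum_le_sum fun c _ => hstep c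
    _ = T.card * a := by rw [Finset.sum_const, nsmul_eq_mul]
    _ ≤ 2 * k * a := mul_le_mul_of_nonneg_right hTcard ha

/-- If at most `k` members are non-zero at `x`, `x⁺`, `x⁻`, and each member's second difference is `≤ a₂`, then `Σ_c |ζ_c(x⁺) + ζ_c(x⁻) − 2ζ_c(x)| ≤ 3k·a₂`. [folklore] -/
theorem sum_abs_second_le_of_alive (ζ : ι → X → ℝ) (x xp xm : X) {k : ℕ} {a₂ : ℝ} (ha : 0 ≤ a₂)
    (hk : ∀ y : X, (Finset.univ.filter fun c : ι => ζ c y ≠ 0).card ≤ k) (hsec : ∀ c, |ζ c xp + ζ c xm - 2 * ζ c x| ≤ a₂) :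
    ∑ c : ι, |ζ c xp + ζ c xm - 2 * ζ c x| ≤ 3 * k * a₂ := by
  classical
  set T := Finset.univ.filter fun c : ι => ζ c x ≠ 0 ∨ ζ c xp ≠ 0 ∨ ζ c xm ≠ 0 with hT
  have hTcard : (T.card : ℝ) ≤ 3 * k := by
    have h1 : T ⊆ ((Finset.univ.filter fun c : ι => ζ c x ≠ 0) ∪ (Finset.univ.filter fun c : ι => ζ c xp ≠ 0))
        ∪ (Finset.univ.filter fun c : ι => ζ c xm ≠ 0) := by
      intro c hc
      rw [hT, Finset.mem_filter] at hc
      simp only [Finset.mem_union, Finset.mem_filter, Finset.mem_univ, true_and]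
      tauto
    have h2 := (Finset.card_le_card h1).trans ((Finset.card_union_le _ _).trans (Nat.add_le_add_right (Finset.card_union_le _ _) _))
    have h3 := hk x
    have h4 := hk xp
    have h5 := hk xm
    have : (T.card : ℝ) ≤ ((Finset.univ.filter fun c : ι => ζ c x ≠ 0).card : ℝ) + ((Finset.univ.filter fun c : ι => ζ c xp ≠ 0).card : ℝ)
        + ((Finset.univ.filter fun c : ι => ζ c xm ≠ 0).card : ℝ) := by exact_mod_cast h2
    have h3' : (((Finset.univ.filter fun c : ι => ζ c x ≠ 0).card : ℕ) : ℝ) ≤ k := by exact_mod_cast h3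
    have h4' : (((Finset.univ.filter fun c : ι => ζ c xp ≠ 0).card : ℕ) : ℝ) ≤ k := by exact_mod_cast h4
    have h5' : (((Finset.univ.filter fun c : ι => ζ c xm ≠ 0).card : ℕ) : ℝ) ≤ k := by exact_mod_cast h5
    linarith
  have hzero : ∀ c ∉ T, |ζ c xp + ζ c xm - 2 * ζ c x| = 0 := by
    intro c hc
    rw [hT, Finset.mem_filter, not_and] at hc
    have h := hc (Finset.mem_univ c)
    push Not at h
    rw [h.1, h.2.1, h.2.2]; norm_num
  rw [← Finset.sum_subset (Finset.subset_univ T) fun c _ hc => hzero c hc]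
  calc ∑ c ∈ T, |ζ c xp + ζ c xm - 2 * ζ c x| ≤ ∑ _c ∈ T, a₂ := Finset.sum_le_sum fun c _ => hsec c
    _ = T.card * a₂ := by rw [Finset.sum_const, nsmul_eq_mul]
    _ ≤ 3 * k * a₂ := mul_le_mul_of_nonneg_right hTcard ha

end Count

/-! ## §2 Entrywise weighted Cauchy–Schwarz for matrices; weighted family sums -/

section CS

variable {ι : Type*} {N : ℕ}

/-- `hs(Σ_c w_c • X_c) ≤ (Σ_c |w_c|)·Σ_c |w_c|·hs(X_c)` (weighted Cauchy–Schwarz, entry by entry). [folklore] -/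
theorem hs_sum_smul_le (s : Finset ι) (w : ι → ℝ) (X : ι → Matrix (Fin N) (Fin N) ℂ) :
    ∑ j : Fin N, ∑ k : Fin N, ‖(∑ c ∈ s, w c • X c) j k‖ ^ 2 ≤ (∑ c ∈ s, |w c|) * ∑ c ∈ s, |w c| * ∑ j : Fin N, ∑ k : Fin N, ‖X c j k‖ ^ 2 := by
  have hjk : ∀ j k, ‖(∑ c ∈ s, w c • X c) j k‖ ^ 2 ≤ (∑ c ∈ s, |w c|) * ∑ c ∈ s, |w c| * ‖X c j k‖ ^ 2 := by
    intro j k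
    rw [Matrix.sum_apply]
    have h := norm_sq_sum_smul_le s w (fun c => X c j k)
    have e : ∑ c ∈ s, (w c • X c) j k = ∑ c ∈ s, w c • X c j k := Finset.sum_congr rfl fun c _ => by rw [Matrix.smul_apply]
    rw [e]; exact h
  calc ∑ j : Fin N, ∑ k : Fin N, ‖(∑ c ∈ s, w c • X c) j k‖ ^ 2
      ≤ ∑ j : Fin N, ∑ k : Fin N, (∑ c ∈ s, |w c|) * ∑ c ∈ s, |w c| * ‖X c j k‖ ^ 2 :=
        Finset.sum_le_sum fun j _ => Finset.sum_le_sum fun k _ => hjk j k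
    _ = (∑ c ∈ s, |w c|) * ∑ c ∈ s, |w c| * ∑ j : Fin N, ∑ k : Fin N, ‖X c j k‖ ^ 2 := by
        simp only [Finset.mul_sum]
        calc ∑ j : Fin N, ∑ k : Fin N, ∑ c ∈ s, (∑ i ∈ s, |w i|) * (|w c| * ‖X c j k‖ ^ 2)
            = ∑ j : Fin N, ∑ c ∈ s, ∑ k : Fin N, (∑ i ∈ s, |w i|) * (|w c| * ‖X c j k‖ ^ 2) := Finset.sum_congr rfl fun j _ => Finset.sum_comm
          _ = ∑ c ∈ s, ∑ j : Fin N, ∑ k : Fin N, (∑ i ∈ s, |w i|) * (|w c| * ‖X c j k‖ ^ 2) := Finset.sum_comm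

/-- A weighted family sum with weights `≤ a` is `≤ a·`(the unweighted sum) for non-negative terms. [folklore] -/
theorem sum_weight_mul_le (s : Finset ι) (w g : ι → ℝ) {a : ℝ} (hw : ∀ c ∈ s, |w c| ≤ a) (hg : ∀ c ∈ s, 0 ≤ g c) :
    ∑ c ∈ s, |w c| * g c ≤ a * ∑ c ∈ s, g c := by
  rw [Finset.mul_sum]
  exact Finset.sum_le_sum fun c hc => mul_le_mul_of_nonneg_right (hw c hc) (hg c hc)

end CS

/-! ## §3 ★★ ROW 1 summed over the family (function side) -/

section Rows

variable (F : T3Family) (n K : ℕ) (c₀ : ℝ) [Fact (0 < c₀)] (W : GaugeField (F.P K) 0 (Matrix.specialUnitaryGroup (Fin 2) ℂ))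
variable {ι : Type*} [Fintype ι] [DecidableEq ι] (ζ : ι → Site (F.P K) 0 → ℝ) (l : ι → Site (F.P K) 0 → Matrix (Fin 2) (Fin 2) ℂ)

/-- ★★ **ROW 1, SUMMED**: with at most `k` cutoffs alive at every site and steps `≤ a`,
`c₀·Σ_b hs(Σ_c (η⁻¹(ζ_c(b₊) − ζ_c(b₋)))•Ad(W_b)λ_c(b₊)) ≤ 6k·a²·η⁻²·Σ_c (c₀·Σ_x hs(λ_c x))`. [cite: Balaban1985BackgroundPropagators, (3.100) pp.413–414] -/
theorem hs_sum_grad_comm_le {k : ℕ} {a : ℝ} (ha : 0 ≤ a)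
    (hk : ∀ y : Site (F.P K) 0, (Finset.univ.filter fun c : ι => ζ c y ≠ 0).card ≤ k)
    (hstep : ∀ c (x : Site (F.P K) 0) (μ : Fin 3), |ζ c (x.shift μ) - ζ c x| ≤ a) :
    c₀ * ∑ b : PBond (F.P K) 0, ∑ j : Fin 2, ∑ k' : Fin 2,
        ‖(∑ c : ι, ((eta F n K)⁻¹ * (ζ c b.tgt - ζ c b.src)) • R (bgUnits F K W b) (l c b.tgt)) j k'‖ ^ 2
      ≤ 6 * k * a ^ 2 * ((eta F n K)⁻¹) ^ 2 * ∑ c : ι, (c₀ * ∑ x : Site (F.P K) 0, ∑ j : Fin 2, ∑ k' : Fin 2, ‖l c x j k'‖ ^ 2) := by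
  have hc : (0 : ℝ) < c₀ := Fact.out
  have hη : 0 < (eta F n K)⁻¹ := inv_pos.mpr (eta_pos F n K)
  -- per bond: weighted CS with weights `η⁻¹ ∂ζ_c(b)`
  have hbond : ∀ b : PBond (F.P K) 0, ∑ j : Fin 2, ∑ k' : Fin 2,
      ‖(∑ c : ι, ((eta F n K)⁻¹ * (ζ c b.tgt - ζ c b.src)) • R (bgUnits F K W b) (l c b.tgt)) j k'‖ ^ 2
      ≤ (2 * k * a * (eta F n K)⁻¹) * ((eta F n K)⁻¹ * a * ∑ c : ι, ∑ j : Fin 2, ∑ k' : Fin 2, ‖l c b.tgt j k'‖ ^ 2) := by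
    intro b
    have h1 := hs_sum_smul_le (N := 2) Finset.univ (fun c : ι => (eta F n K)⁻¹ * (ζ c b.tgt - ζ c b.src)) (fun c => R (bgUnits F K W b) (l c b.tgt))
    have e : ∀ c : ι, |(eta F n K)⁻¹ * (ζ c b.tgt - ζ c b.src)| = (eta F n K)⁻¹ * |ζ c b.tgt - ζ c b.src| := fun c => by
      rw [abs_mul, abs_of_pos hη]
    have hst : ∀ c : ι, |ζ c b.tgt - ζ c b.src| ≤ a := fun c => hstep c b.src b.dir
    have hw : ∑ c : ι, |(eta F n K)⁻¹ * (ζ c b.tgt - ζ c b.src)| ≤ 2 * k * a * (eta F n K)⁻¹ := by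
      simp_rw [e]
      rw [← Finset.mul_sum]
      have := sum_abs_sub_le_of_alive ζ b.src b.tgt ha hk hst
      calc (eta F n K)⁻¹ * ∑ c : ι, |ζ c b.tgt - ζ c b.src| ≤ (eta F n K)⁻¹ * (2 * k * a) := mul_le_mul_of_nonneg_left this hη.le
        _ = 2 * k * a * (eta F n K)⁻¹ := by ring
    have hhs0 : ∀ c : ι, 0 ≤ ∑ j : Fin 2, ∑ k' : Fin 2, ‖l c b.tgt j k'‖ ^ 2 := fun c => Finset.sum_nonneg fun _ _ => Finset.sum_nonneg fun _ _ => sq_nonneg _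
    have hw2 : ∑ c : ι, |(eta F n K)⁻¹ * (ζ c b.tgt - ζ c b.src)| * ∑ j : Fin 2, ∑ k' : Fin 2, ‖(R (bgUnits F K W b) (l c b.tgt)) j k'‖ ^ 2
        ≤ (eta F n K)⁻¹ * a * ∑ c : ι, ∑ j : Fin 2, ∑ k' : Fin 2, ‖l c b.tgt j k'‖ ^ 2 := by
      rw [Finset.mul_sum]
      refine Finset.sum_le_sum fun c _ => ?_
      rw [sum_norm_sq_R (coe_bgUnits_mem_unitary' F K W b), e c]
      exact mul_le_mul_of_nonneg_right (mul_le_mul_of_nonneg_left (hst c) hη.le) (hhs0 c)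
    have hS2 : 0 ≤ ∑ c : ι, |(eta F n K)⁻¹ * (ζ c b.tgt - ζ c b.src)| * ∑ j : Fin 2, ∑ k' : Fin 2, ‖(R (bgUnits F K W b) (l c b.tgt)) j k'‖ ^ 2 :=
      Finset.sum_nonneg fun c _ => mul_nonneg (abs_nonneg _) (Finset.sum_nonneg fun _ _ => Finset.sum_nonneg fun _ _ => sq_nonneg _)
    have hA1 : 0 ≤ 2 * k * a * (eta F n K)⁻¹ := by positivity
    exact h1.trans (mul_le_mul hw hw2 hS2 hA1)
  -- sum over bonds, re-index by targets
  have hsum := Finset.sum_le_sum fun b (_ : b ∈ (Finset.univ : Finset (PBond (F.P K) 0))) => hbond b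
  have htgt : ∑ b : PBond (F.P K) 0, ∑ c : ι, ∑ j : Fin 2, ∑ k' : Fin 2, ‖l c b.tgt j k'‖ ^ 2
      = 3 * ∑ c : ι, ∑ x : Site (F.P K) 0, ∑ j : Fin 2, ∑ k' : Fin 2, ‖l c x j k'‖ ^ 2 := by
    rw [sum_pbond_tgt F K (fun _ x => ∑ c : ι, ∑ j : Fin 2, ∑ k' : Fin 2, ‖l c x j k'‖ ^ 2), Finset.sum_const, Finset.card_univ, Fintype.card_fin,
      nsmul_eq_mul, Nat.cast_ofNat, Finset.sum_comm]
  have hL : ∑ b : PBond (F.P K) 0, ∑ j : Fin 2, ∑ k' : Fin 2,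
      ‖(∑ c : ι, ((eta F n K)⁻¹ * (ζ c b.tgt - ζ c b.src)) • R (bgUnits F K W b) (l c b.tgt)) j k'‖ ^ 2
      ≤ (2 * k * a * (eta F n K)⁻¹) * ((eta F n K)⁻¹ * a * (3 * ∑ c : ι, ∑ x : Site (F.P K) 0, ∑ j : Fin 2, ∑ k' : Fin 2, ‖l c x j k'‖ ^ 2)) := by
    refine hsum.trans (le_of_eq ?_)
    rw [← htgt]
    simp only [Finset.mul_sum]
  calc c₀ * ∑ b : PBond (F.P K) 0, ∑ j : Fin 2, ∑ k' : Fin 2,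
          ‖(∑ c : ι, ((eta F n K)⁻¹ * (ζ c b.tgt - ζ c b.src)) • R (bgUnits F K W b) (l c b.tgt)) j k'‖ ^ 2
      ≤ c₀ * ((2 * k * a * (eta F n K)⁻¹) * ((eta F n K)⁻¹ * a * (3 * ∑ c : ι, ∑ x : Site (F.P K) 0, ∑ j : Fin 2, ∑ k' : Fin 2, ‖l c x j k'‖ ^ 2))) :=
        mul_le_mul_of_nonneg_left hL hc.le
    _ = 6 * k * a ^ 2 * ((eta F n K)⁻¹) ^ 2 * ∑ c : ι, (c₀ * ∑ x : Site (F.P K) 0, ∑ j : Fin 2, ∑ k' : Fin 2, ‖l c x j k'‖ ^ 2) := by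
        rw [← Finset.mul_sum]
        ring

end Rows

end Summit.QuantumFields.YangMills.Theorems.Prop7Lane2CutoffFamilyRows

end
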